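import Literature.Barriers.PneNP.TSPExtensionComplexityRothvossSampling
import Literature.Barriers.PneNP.TSPExtensionComplexityMatchingTransport
import Mathlib.Data.Fintype.Pi
import HarnessLib

/-!
# Rothvoß's partitions: the sizes of the extension sets (normalisations of `p_M`, `p_U`)

Support file for the discharge of `Literature.Barriers.PneNP.Rothvoss2017_tsp` (route of
`…RothvossBridge.lean`). Rothvoß's §3.4 (PDF p. 10) compares the conditional probabilities
`p^ex_{M,T}(H)`, `p_{M,T}(F)`, `p^ex_{U,T}(H)`, `p^ex_{U,T}(C)` for a `3`-matching `H ⊆ F`, a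
`k`-matching between `C` and `D`; turning these comparisons of RATIOS into comparisons of COUNTS
(which is what the sample spaces `Ω_3`, `Ω_k` of `…RothvossSampling.lean` are made of) needs the
sizes of the extension sets, i.e. that they do not depend on `H`, `F` or `T`. Using the block
product and transport lemmas of `…MatchingsOps.lean` / `…MatchingTransport.lean`:

* `blkC lab c` — the edge classes of `T` (`A_i`, `B_i`, `C ∪ D`); `Mall` = block-respecting
  perfect matchings (`mem_Mall_iff_blocks`), `card_blockPM_restrict` (product counting with one
  block's matchings restricted);
* `card_Mext_k` — for a `k`-matching `F`: `|M^ex(T,F)| = w_T := Π_{c ≠ C∪D} |PM(block c)|`;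
  `card_Mext_eq` — for an `r`-matching `H`: `|M^ex(T,H)| = |pmCDH T H| · w_T` where `pmCDH` = the
  perfect matchings of `C ∪ D` whose `C`–`D` edges are exactly `H`; `card_pmCDH` —
  `|pmCDH T H| = P(k-r)²`, `P(s)` = number of perfect matchings of `s` points;
* `card_kext` — the number `c₁` of `k`-matchings `F ⊇ H` between `C` and `D` is `|bipPM|` of two
  `(k-r)`-sets, hence independent of `(T, H)` (`card_kext_eq`);
* `card_Uext` — `|U^ex(T,H)| = C(m, j)` for `t = r + j(k-3)`.

Sources: [Rothvoss2017] §3.2 (PDF p. 9), §3.4 (PDF p. 10), proof of Lemma 15 (PDF p. 12: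
"X := X₁ × … × X_{2m+1}", "some (huge) constant depending on k").
-/

noncomputable section

namespace Literature.Barriers.PneNP

open Finset Literature.Combinatorics.SimpleGraph.CycleSpace Lbl

/-! ### Product counting with restricted blocks -/

section Blocks

variable {V ι : Type*} [DecidableEq V] [Fintype ι] [DecidableEq ι] (P : ι → Finset V)

/-- **Block product with restricted families**: for pairwise disjoint blocks and families
`𝒢 i ⊆ PM(P i)`, the block-respecting perfect matchings of `⋃ P i` whose restriction to each
block `i` lies in `𝒢 i` number `Π |𝒢 i|` (the tree's `blockPM_bij`). [folklore] -/
theorem card_blockPM_restrict (hP : ∀ i j, i ≠ j → Disjoint (P i) (P j))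
    (𝒢 : ι → Finset (Finset (Sym2 V))) (h𝒢 : ∀ i, 𝒢 i ⊆ perfectMatchings (P i)) :
    ((perfectMatchings (univ.biUnion P)).filter fun M =>
        (∀ e ∈ M, ∃ i, e ∈ (P i).sym2) ∧ ∀ i, (M.filter fun e => e ∈ (P i).sym2) ∈ 𝒢 i).card =
      ∏ i, (𝒢 i).card := by
  rw [← Fintype.card_piFinset]
  obtain ⟨h1, h2⟩ := blockPM_bij P hP
  refine card_nbij' (fun M i => M.filter fun e => e ∈ (P i).sym2) (fun g => univ.biUnion g)
    (fun M hM => ?_) (fun g hg => ?_) (fun M hM => ?_) (fun g hg => ?_)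
  · rw [mem_coe, mem_filter] at hM
    rw [mem_coe, Fintype.mem_piFinset]
    exact hM.2.2
  · rw [mem_coe, Fintype.mem_piFinset] at hg
    have hg' : g ∈ Fintype.piFinset fun i => perfectMatchings (P i) :=
      Fintype.mem_piFinset.2 fun i => h𝒢 i (hg i)
    rw [mem_coe, mem_filter, mem_perfectMatchings]
    refine ⟨(h1 g hg').1.1, (h1 g hg').1.2, fun i => ?_⟩
    have := congrFun (h1 g hg').2 i
    rw [this]
    exact hg i
  · rw [mem_coe, mem_filter, mem_perfectMatchings] at hM
    exact (h2 M hM.1 hM.2.1).2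
  · rw [mem_coe, Fintype.mem_piFinset] at hg
    have hg' : g ∈ Fintype.piFinset fun i => perfectMatchings (P i) :=
      Fintype.mem_piFinset.2 fun i => h𝒢 i (hg i)
    exact (h1 g hg').2

end Blocks

/-! ### The edge classes of a partition -/

variable {n m k : ℕ}

/-- The edge class `c` of the partition: the vertices `v` with `cls (lab v) = c` (`A_i`, `B_i`,
`C ∪ D` for `c = C`, empty for `c = D`). [cite: Rothvoss2017, §3.1 (PDF p. 8: "E(T)")] -/
def blkC (lab : Fin n → Lbl m) (c : Lbl m) : Finset (Fin n) := univ.filter fun v => cls (lab v) = c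

/-- Membership in an edge class. [folklore] -/
@[simp] theorem mem_blkC {lab : Fin n → Lbl m} {c : Lbl m} {v : Fin n} :
    v ∈ blkC lab c ↔ cls (lab v) = c := by
  simp [blkC]

/-- The edge classes are pairwise disjoint. [folklore] -/
theorem blkC_disjoint (lab : Fin n → Lbl m) : ∀ c c' : Lbl m, c ≠ c' → Disjoint (blkC lab c) (blkC lab c') := by
  intro c c' hne
  rw [disjoint_left]
  intro v hv hv'
  rw [mem_blkC] at hv hv'
  exact hne (hv.symm.trans hv')

/-- The edge classes cover everything. [folklore] -/
theorem biUnion_blkC (lab : Fin n → Lbl m) : (univ : Finset (Lbl m)).biUnion (blkC lab) = univ := by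
  ext v
  simp only [mem_biUnion, mem_univ, true_and, iff_true, mem_blkC]
  exact ⟨_, rfl⟩

/-- An edge respects `T` iff it lies inside an edge class. [folklore] -/
theorem eResp_iff_exists_blkC {lab : Fin n → Lbl m} {e : Sym2 (Fin n)} :
    EResp lab e ↔ ∃ c, e ∈ (blkC lab c).sym2 := by
  induction e using Sym2.ind with
  | h u v =>
    rw [eResp_mk]
    simp only [mk_mem_sym2_iff, mem_blkC]
    constructor
    · intro h; exact ⟨_, rfl, h.symm⟩
    · rintro ⟨c, hu, hv⟩; rw [hu, hv]

/-- The class `C ∪ D`. [folklore] -/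
theorem blkC_C (lab : Fin n → Lbl m) : blkC lab Lbl.C = lblk lab Lbl.C ∪ lblk lab Lbl.D := by
  ext v
  simp [mem_blkC, mem_lblk, cls_eq_C_iff]

/-- **`M_all(T)` = the block-respecting perfect matchings** for the edge classes. [folklore] -/
theorem mem_Mall_iff_blocks {lab : Fin n → Lbl m} {M : Finset (Sym2 (Fin n))} :
    M ∈ Mall lab ↔ M ∈ perfectMatchings ((univ : Finset (Lbl m)).biUnion (blkC lab)) ∧
      ∀ e ∈ M, ∃ c, e ∈ (blkC lab c).sym2 := by
  rw [biUnion_blkC, mem_Mall_iff, mem_perfectMatchings]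
  simp only [eResp_iff_exists_blkC]

/-! ### Perfect matchings of `C ∪ D` with prescribed `C`–`D` edges -/

/-- The perfect matchings of `C ∪ D` whose edges between `C` and `D` are exactly `H`.
[cite: Rothvoss2017, proof of Lemma 8 (PDF p. 9: "F ∼ {F' ⊆ E(C ∪ D) | δ(C) ∩ F' = H}")] -/
def pmCDH (lab : Fin n → Lbl m) (H : Finset (Sym2 (Fin n))) : Finset (Finset (Sym2 (Fin n))) :=
  (perfectMatchings (blkC lab Lbl.C)).filter fun F => F.filter (IsCD lab) = H

/-- Membership in `pmCDH`. [folklore] -/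
theorem mem_pmCDH_iff {lab : Fin n → Lbl m} {H F : Finset (Sym2 (Fin n))} :
    F ∈ pmCDH lab H ↔ IsPMOn (blkC lab Lbl.C) F ∧ F.filter (IsCD lab) = H := by
  simp [pmCDH, mem_perfectMatchings]

/-- `C`–`D` edges lie inside the class `C ∪ D`. [folklore] -/
theorem IsCD.mem_blkC_sym2 {lab : Fin n → Lbl m} {e : Sym2 (Fin n)} (h : IsCD lab e) :
    e ∈ (blkC lab Lbl.C).sym2 := by
  obtain ⟨c, d, rfl, hc, hd⟩ := h
  rw [mk_mem_sym2_iff, mem_blkC, mem_blkC, hc, hd]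
  exact ⟨rfl, rfl⟩

/-- The restriction of a member of `M_all(T)` to `C ∪ D` has the same `C`–`D` edges. [folklore] -/
theorem filter_isCD_filter_blkC {lab : Fin n → Lbl m} (M : Finset (Sym2 (Fin n))) :
    (M.filter fun e => e ∈ (blkC lab Lbl.C).sym2).filter (IsCD lab) = M.filter (IsCD lab) := by
  ext e
  simp only [mem_filter]
  constructor
  · rintro ⟨⟨he, -⟩, hcd⟩; exact ⟨he, hcd⟩
  · rintro ⟨he, hcd⟩; exact ⟨⟨he, hcd.mem_blkC_sym2⟩, hcd⟩

/-- **`M^ex(T,H)` as a restricted block product**: `M ∈ M^ex(T,H)` iff `M` is a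
block-respecting perfect matching whose `C ∪ D`-block lies in `pmCDH T H` (other blocks free).
[folklore] -/
theorem mem_Mext_iff_blocks {lab : Fin n → Lbl m} {H M : Finset (Sym2 (Fin n))} :
    M ∈ Mext lab H ↔ M ∈ perfectMatchings ((univ : Finset (Lbl m)).biUnion (blkC lab)) ∧
      (∀ e ∈ M, ∃ c, e ∈ (blkC lab c).sym2) ∧
      ∀ c, (M.filter fun e => e ∈ (blkC lab c).sym2) ∈
        (fun c => if c = Lbl.C then pmCDH lab H else perfectMatchings (blkC lab c)) c := by
  rw [mem_Mext_iff, mem_Mall_iff_blocks]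
  constructor
  · rintro ⟨⟨hPM, hresp⟩, hH⟩
    refine ⟨hPM, hresp, fun c => ?_⟩
    have hblock : IsPMOn (blkC lab c) (M.filter fun e => e ∈ (blkC lab c).sym2) :=
      (mem_perfectMatchings.1 hPM).filter_block (blkC lab) (blkC_disjoint lab) univ
        (fun e he => by obtain ⟨c, hc⟩ := hresp e he; exact ⟨c, mem_univ _, hc⟩) (mem_univ c)
    by_cases hc : c = Lbl.C
    · subst hc
      simp only [if_true]
      exact mem_pmCDH_iff.2 ⟨hblock, by rw [filter_isCD_filter_blkC, hH]⟩
    · simp only [if_neg hc]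
      exact mem_perfectMatchings.2 hblock
  · rintro ⟨hPM, hresp, hblk⟩
    refine ⟨⟨hPM, hresp⟩, ?_⟩
    have := hblk Lbl.C
    simp only [if_true] at this
    rw [← filter_isCD_filter_blkC, (mem_pmCDH_iff.1 this).2]

/-- The normalisation `w_T := Π_{c ≠ C∪D} |PM(block c)|`. [cite: Rothvoss2017, proof of Lemma 15 (PDF p. 12)] -/
def wT (lab : Fin n → Lbl m) : ℕ := ∏ c ∈ (univ : Finset (Lbl m)).erase Lbl.C, (perfectMatchings (blkC lab c)).card

/-- **`|M^ex(T,H)| = |pmCDH T H| · w_T`.** [cite: Rothvoss2017, §3.2 (PDF p. 9), proof of Lemma 15 (PDF p. 12)] -/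
theorem card_Mext_eq (lab : Fin n → Lbl m) (H : Finset (Sym2 (Fin n))) :
    (Mext lab H).card = (pmCDH lab H).card * wT lab := by
  let 𝒢 : Lbl m → Finset (Finset (Sym2 (Fin n))) :=
    fun c => if c = Lbl.C then pmCDH lab H else perfectMatchings (blkC lab c)
  have h𝒢 : ∀ c, 𝒢 c ⊆ perfectMatchings (blkC lab c) := by
    intro c
    by_cases hc : c = Lbl.C
    · subst hc; simp only [𝒢, if_true]; exact filter_subset _ _
    · simp only [𝒢, if_neg hc]; exact Subset.rfl
  have hset : Mext lab H = (perfectMatchings ((univ : Finset (Lbl m)).biUnion (blkC lab))).filter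
      fun M => (∀ e ∈ M, ∃ c, e ∈ (blkC lab c).sym2) ∧
        ∀ c, (M.filter fun e => e ∈ (blkC lab c).sym2) ∈ 𝒢 c := by
    ext M
    rw [mem_Mext_iff_blocks, mem_filter]
  have key := card_blockPM_restrict (blkC lab) (blkC_disjoint lab) 𝒢 h𝒢
  have hprod : ∏ c, (𝒢 c).card = (pmCDH lab H).card * wT lab := by
    rw [wT, ← Finset.prod_erase_mul _ _ (mem_univ Lbl.C)]
    simp only [𝒢, if_true, mul_comm]
    congr 1
    exact prod_congr rfl fun c hc => by rw [if_neg (ne_of_mem_erase hc)]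
  rw [hset, ← hprod]
  convert key using 2
  ext M
  simp only [mem_filter]

/-! ### `|pmCDH T H| = P(k-r)²` -/

/-- The vertices of `D` covered by `H`. [folklore] -/
def covD (lab : Fin n → Lbl m) (H : Finset (Sym2 (Fin n))) : Finset (Fin n) :=
  (lblk lab Lbl.D).filter fun d => ∃ e ∈ H, d ∈ e

/-- `|covD H| = r`. [folklore] -/
theorem card_covD {lab : Fin n → Lbl m} {r : ℕ} {H : Finset (Sym2 (Fin n))}
    (hH : H ∈ cdMatchings lab r) : (covD lab H).card = r :=
  card_filter_lblk_covered hH (Or.inr rfl)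

/-- `verts H ⊆ C ∪ D`. [folklore] -/
theorem verts_subset_blkC {lab : Fin n → Lbl m} {r : ℕ} {H : Finset (Sym2 (Fin n))}
    (hH : H ∈ cdMatchings lab r) : verts H ⊆ blkC lab Lbl.C := by
  intro v hv
  rw [mem_blkC, cls_eq_C_iff]
  exact label_of_mem_verts hH hv

/-- The number of perfect matchings of `s` labelled points. [folklore] -/
def pmCount (s : ℕ) : ℕ := (perfectMatchings (univ : Finset (Fin s))).card

section PMCDH

variable {lab : Fin n → Lbl m} {r : ℕ} {H : Finset (Sym2 (Fin n))}

variable (lab H) in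
/-- The two blocks `C ∖ V(H)` (index `true`) and `D ∖ V(H)` (index `false`). [folklore] -/
def restBlk : Bool → Finset (Fin n)
  | true => (lblk lab Lbl.C).filter fun v => v ∉ verts H
  | false => (lblk lab Lbl.D).filter fun v => v ∉ verts H

/-- The two rest blocks are disjoint. [folklore] -/
theorem restBlk_disjoint : ∀ i j, i ≠ j → Disjoint (restBlk lab H i) (restBlk lab H j) := by
  intro i j hij
  rw [disjoint_left]
  intro v hv hv'
  cases i <;> cases j
  · exact hij rfl
  · simp only [restBlk, mem_filter, mem_lblk] at hv hv'
    have := hv.1.symm.trans hv'.1; cases this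
  · simp only [restBlk, mem_filter, mem_lblk] at hv hv'
    have := hv.1.symm.trans hv'.1; cases this
  · exact hij rfl

/-- The sizes of the rest blocks: `k - r` each. [folklore] -/
theorem card_restBlk (hlab : lab ∈ partitions n m k) (hH : H ∈ cdMatchings lab r) (i : Bool) :
    (restBlk lab H i).card = k - r := by
  have hC := (mem_partitions_iff.1 hlab) Lbl.C
  have hD := (mem_partitions_iff.1 hlab) Lbl.D
  have hsplit : ∀ ℓ, ((lblk lab ℓ).filter fun v => v ∈ verts H).card +
      ((lblk lab ℓ).filter fun v => v ∉ verts H).card = (lblk lab ℓ).card :=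
    fun ℓ => card_filter_add_card_filter_not _
  have hcovℓ : ∀ ℓ, (ℓ = Lbl.C ∨ ℓ = Lbl.D) → ((lblk lab ℓ).filter fun v => v ∈ verts H).card = r := by
    intro ℓ hℓ
    have : ((lblk lab ℓ).filter fun v => v ∈ verts H) = (lblk lab ℓ).filter fun c => ∃ e ∈ H, c ∈ e :=
      filter_congr fun v _ => by rw [mem_verts]
    rw [this]; exact card_filter_lblk_covered hH hℓ
  cases i
  · have h1 := hsplit Lbl.D
    rw [hcovℓ Lbl.D (Or.inr rfl), hD] at h1
    simp only [restBlk]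
    have : Lbl.size k (Lbl.D : Lbl m) = k := rfl
    omega
  · have h1 := hsplit Lbl.C
    rw [hcovℓ Lbl.C (Or.inl rfl), hC] at h1
    simp only [restBlk]
    have : Lbl.size k (Lbl.C : Lbl m) = k := rfl
    omega

/-- `C ∪ D = V(H) ∪ (C ∖ V(H)) ∪ (D ∖ V(H))`. [folklore] -/
theorem blkC_eq_verts_union_rest (hH : H ∈ cdMatchings lab r) :
    blkC lab Lbl.C = verts H ∪ (univ : Finset Bool).biUnion (restBlk lab H) := by
  ext v
  simp only [mem_union, mem_biUnion, mem_univ, true_and, mem_blkC, cls_eq_C_iff]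
  constructor
  · intro hv
    by_cases hvH : v ∈ verts H
    · exact Or.inl hvH
    · rcases hv with h | h
      · exact Or.inr ⟨true, mem_filter.2 ⟨mem_lblk.2 h, hvH⟩⟩
      · exact Or.inr ⟨false, mem_filter.2 ⟨mem_lblk.2 h, hvH⟩⟩
  · rintro (hv | ⟨i, hi⟩)
    · exact label_of_mem_verts hH hv
    · cases i
      · exact Or.inr (mem_lblk.1 (mem_filter.1 hi).1)
      · exact Or.inl (mem_lblk.1 (mem_filter.1 hi).1)

/-- `V(H)` is disjoint from the rest blocks. [folklore] -/
theorem verts_disjoint_rest : Disjoint (verts H) ((univ : Finset Bool).biUnion (restBlk lab H)) := by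
  rw [disjoint_biUnion_right]
  intro i _
  rw [disjoint_left]
  intro v hv hv'
  cases i <;> exact (mem_filter.1 hv').2 hv

/-- An edge inside `C ∪ D` avoiding `V(H)` that is not a `C`–`D` edge lies inside one rest block.
[folklore] -/
theorem mem_restBlk_sym2_of_not_isCD {e : Sym2 (Fin n)} (he : e ∈ (blkC lab Lbl.C).sym2)
    (hv : ∀ v ∈ e, v ∉ verts H) (hcd : ¬IsCD lab e) : ∃ i, e ∈ (restBlk lab H i).sym2 := by
  induction e using Sym2.ind with
  | h u v =>
    rw [mk_mem_sym2_iff, mem_blkC, mem_blkC, cls_eq_C_iff, cls_eq_C_iff] at he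
    rw [isCD_mk] at hcd
    push Not at hcd
    have hu := hv u (Sym2.mem_mk_left u v)
    have hv' := hv v (Sym2.mem_mk_right u v)
    rcases he.1 with hlu | hlu <;> rcases he.2 with hlv | hlv
    · exact ⟨true, by rw [mk_mem_sym2_iff]; exact ⟨mem_filter.2 ⟨mem_lblk.2 hlu, hu⟩, mem_filter.2 ⟨mem_lblk.2 hlv, hv'⟩⟩⟩
    · exact absurd hlv (hcd.1 hlu)
    · exact absurd hlv (hcd.2 hlu)
    · exact ⟨false, by rw [mk_mem_sym2_iff]; exact ⟨mem_filter.2 ⟨mem_lblk.2 hlu, hu⟩, mem_filter.2 ⟨mem_lblk.2 hlv, hv'⟩⟩⟩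

/-- An edge inside a rest block is not a `C`–`D` edge and avoids `V(H)`. [folklore] -/
theorem not_isCD_of_mem_restBlk_sym2 {e : Sym2 (Fin n)} {i : Bool} (he : e ∈ (restBlk lab H i).sym2) :
    ¬IsCD lab e ∧ ∀ v ∈ e, v ∉ verts H := by
  induction e using Sym2.ind with
  | h u v =>
    rw [mk_mem_sym2_iff] at he
    obtain ⟨hu, hv⟩ := he
    constructor
    · rw [isCD_mk]
      cases i <;> simp only [restBlk, mem_filter, mem_lblk] at hu hv <;>
        rintro (⟨h1, h2⟩ | ⟨h1, h2⟩)
      · rw [hu.1] at h1; cases h1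
      · rw [hv.1] at h2; cases h2
      · rw [hv.1] at h2; cases h2
      · rw [hu.1] at h1; cases h1
    · intro w hw
      rcases Sym2.mem_iff.1 hw with rfl | rfl
      · cases i <;> exact (mem_filter.1 hu).2
      · cases i <;> exact (mem_filter.1 hv).2

/-- **`pmCDH T H` ↔ block-respecting perfect matchings of the rest blocks** (`F ↦ F ∖ H`,
inverse `G ↦ G ∪ H`). [folklore] -/
theorem card_pmCDH_eq_blockPM (hH : H ∈ cdMatchings lab r) :
    (pmCDH lab H).card = ((perfectMatchings ((univ : Finset Bool).biUnion (restBlk lab H))).filter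
      fun G => ∀ e ∈ G, ∃ i, e ∈ (restBlk lab H i).sym2).card := by
  classical
  have hHpm : IsPMOn (verts H) H := isPMOn_verts hH
  have hHcd : ∀ e ∈ H, IsCD lab e := (mem_cdMatchings_iff.1 hH).1
  have hdis := verts_disjoint_rest (lab := lab) (H := H)
  have hsplit := blkC_eq_verts_union_rest hH
  -- `G ∪ H` lies in `pmCDH` for a block-respecting `G`
  have hG : ∀ G : Finset (Sym2 (Fin n)), IsPMOn ((univ : Finset Bool).biUnion (restBlk lab H)) G →
      (∀ e ∈ G, ∃ i, e ∈ (restBlk lab H i).sym2) → G ∪ H ∈ pmCDH lab H ∧ Disjoint G H := by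
    intro G hGpm hGresp
    have hGH : Disjoint G H := by
      rw [disjoint_left]
      intro e heG heH
      obtain ⟨i, hi⟩ := hGresp e heG
      exact (not_isCD_of_mem_restBlk_sym2 hi).1 (hHcd e heH)
    refine ⟨mem_pmCDH_iff.2 ⟨?_, ?_⟩, hGH⟩
    · rw [hsplit]
      have := hHpm.union hGpm hdis
      rwa [union_comm H G] at this
    · ext e
      simp only [mem_filter, mem_union]
      constructor
      · rintro ⟨heG | heH, hcd⟩
        · obtain ⟨i, hi⟩ := hGresp e heG
          exact absurd hcd (not_isCD_of_mem_restBlk_sym2 hi).1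
        · exact heH
      · intro heH
        exact ⟨Or.inr heH, hHcd e heH⟩
  -- `F ∖ H` is block-respecting for `F ∈ pmCDH`
  have hF : ∀ F ∈ pmCDH lab H, IsPMOn ((univ : Finset Bool).biUnion (restBlk lab H)) (F \ H) ∧
      (∀ e ∈ F \ H, ∃ i, e ∈ (restBlk lab H i).sym2) ∧ H ⊆ F := by
    intro F hFm
    obtain ⟨hFpm, hFH⟩ := mem_pmCDH_iff.1 hFm
    have hHF : H ⊆ F := by rw [← hFH]; exact filter_subset _ _
    rw [hsplit] at hFpm
    have hrest : IsPMOn ((univ : Finset Bool).biUnion (restBlk lab H)) (F \ H) := hFpm.sdiff hdis hHpm hHF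
    refine ⟨hrest, fun e he => ?_, hHF⟩
    rw [mem_sdiff] at he
    have hecd : ¬IsCD lab e := fun hcd => he.2 (by rw [← hFH]; exact mem_filter.2 ⟨he.1, hcd⟩)
    refine mem_restBlk_sym2_of_not_isCD ?_ (fun v hv hvH => ?_) hecd
    · rw [hsplit]; exact (hrest.subset_sym2 (mem_sdiff.2 he)) |> sym2_mono subset_union_right
    · exact disjoint_left.1 hdis hvH (mem_sym2_iff.1 (hrest.subset_sym2 (mem_sdiff.2 he)) v hv)
  refine card_nbij' (fun F => F \ H) (fun G => G ∪ H) (fun F hFm => ?_) (fun G hGm => ?_)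
    (fun F hFm => ?_) (fun G hGm => ?_)
  · rw [mem_coe] at hFm
    obtain ⟨h1, h2, -⟩ := hF F hFm
    rw [mem_coe, mem_filter, mem_perfectMatchings]
    exact ⟨h1, h2⟩
  · rw [mem_coe, mem_filter, mem_perfectMatchings] at hGm
    rw [mem_coe]
    exact (hG G hGm.1 hGm.2).1
  · rw [mem_coe] at hFm
    exact sdiff_union_of_subset (hF F hFm).2.2
  · rw [mem_coe, mem_filter, mem_perfectMatchings] at hGm
    exact union_sdiff_cancel_right (hG G hGm.1 hGm.2).2

/-- **`|pmCDH T H| = P(k-r)²`**: the perfect matchings of `C ∪ D` with `C`–`D` edges exactly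
`H` are the pairs (perfect matching of `C ∖ V(H)`, perfect matching of `D ∖ V(H)`), and each
factor counts `P(k-r)`. [cite: Rothvoss2017, proof of Lemma 15 (PDF p. 12: "some (huge) constant depending on k")] -/
theorem card_pmCDH (hlab : lab ∈ partitions n m k) (hH : H ∈ cdMatchings lab r) :
    (pmCDH lab H).card = pmCount (k - r) * pmCount (k - r) := by
  rw [card_pmCDH_eq_blockPM hH]
  have key := card_blockPM (restBlk lab H) restBlk_disjoint
  calc _ = ∏ i, (perfectMatchings (restBlk lab H i)).card := by
        convert key using 2
        ext G
        simp only [mem_filter]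
    _ = pmCount (k - r) * pmCount (k - r) := by
        rw [Fintype.prod_bool, card_perfectMatchings_eq_fin (restBlk lab H true),
          card_perfectMatchings_eq_fin (restBlk lab H false), card_restBlk hlab hH true,
          card_restBlk hlab hH false, pmCount]

end PMCDH

/-! ### `k`-matchings containing `H`: the constant `c₁` -/

section KExt

/-- `V(H) = (V(H) ∩ C) ∪ (V(H) ∩ D)` for a matching between `C` and `D`. [folklore] -/
theorem verts_eq_cov_union_covD' {lab : Fin n → Lbl m} {r : ℕ} {H : Finset (Sym2 (Fin n))}
    (hH : H ∈ cdMatchings lab r) : verts H = cov lab H ∪ covD lab H := by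
  ext v
  simp only [mem_verts, mem_union, mem_cov_iff, covD, mem_filter, mem_lblk]
  constructor
  · rintro ⟨e, he, hve⟩
    rcases label_of_mem_verts hH (mem_verts.2 ⟨e, he, hve⟩) with h | h
    · exact Or.inl ⟨h, e, he, hve⟩
    · exact Or.inr ⟨h, e, he, hve⟩
  · rintro (⟨-, e, he, hve⟩ | ⟨-, e, he, hve⟩) <;> exact ⟨e, he, hve⟩

variable {lab : Fin n → Lbl m} {r : ℕ} {H : Finset (Sym2 (Fin n))}

/-- A perfect matching of `S` has `|S|/2` edges: `2|M| = |S|`. [folklore] -/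
theorem IsPMOn.two_mul_card {V : Type*} [DecidableEq V] {S : Finset V} {M : Finset (Sym2 V)}
    (h : IsPMOn S M) : 2 * M.card = S.card := by
  rw [h.card_eq_sum_cutCount Subset.rfl, mul_comm, Finset.card_eq_sum_ones, sum_mul]
  refine sum_congr rfl fun e he => ?_
  induction e using Sym2.ind with
  | h a b =>
    rw [cutCount_mk, if_pos (h.mem_of_mem he (Sym2.mem_mk_left a b)),
      if_pos (h.mem_of_mem he (Sym2.mem_mk_right a b))]
    rfl

/-- **A `k`-matching between `C` and `D` is a perfect matching of `C ∪ D`** (`|C| = |D| = k`).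
[folklore] -/
theorem isPMOn_of_mem_cdMatchings_k (hlab : lab ∈ partitions n m k) {F : Finset (Sym2 (Fin n))}
    (hF : F ∈ cdMatchings lab k) : IsPMOn (blkC lab Lbl.C) F := by
  have hsub : verts F ⊆ blkC lab Lbl.C := verts_subset_blkC hF
  have hcard : (blkC lab Lbl.C).card ≤ (verts F).card := by
    rw [verts_eq_cov_union_covD' hF, card_union_of_disjoint, card_cov hF, card_covD hF, blkC_C,
      card_union_of_disjoint, (mem_partitions_iff.1 hlab) Lbl.C, (mem_partitions_iff.1 hlab) Lbl.D]
    · exact le_of_eq rfl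
    · rw [disjoint_left]; intro v hv hv'; rw [mem_lblk] at hv hv'; rw [hv] at hv'; cases hv'
    · rw [disjoint_left]; intro v hv hv'
      have h1 := (mem_filter.1 hv).1; have h2 := (mem_filter.1 hv').1
      rw [mem_lblk] at h1 h2; rw [h1] at h2; cases h2
  have heq : verts F = blkC lab Lbl.C := eq_of_subset_of_card_le hsub hcard
  rw [← heq]
  exact isPMOn_verts hF

/-- The rest blocks' union. [folklore] -/
theorem biUnion_restBlk (lab : Fin n → Lbl m) (H : Finset (Sym2 (Fin n))) :
    (univ : Finset Bool).biUnion (restBlk lab H) = restBlk lab H true ∪ restBlk lab H false := by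
  ext v; simp [or_comm]

/-- The `k`-matchings between `C` and `D` containing `H`.
[cite: Rothvoss2017, §3.4 (PDF p. 10: "E_{|F|=k}[E_{H ∼ binom(F,3)}[…]]")] -/
def kext (lab : Fin n → Lbl m) (k : ℕ) (H : Finset (Sym2 (Fin n))) : Finset (Finset (Sym2 (Fin n))) :=
  (cdMatchings lab k).filter fun F => H ⊆ F

/-- **`k`-matchings containing `H` ↔ perfect matchings between `C ∖ V(H)` and `D ∖ V(H)`**
(`F ↦ F ∖ H`), hence `|kext| = |bipPM (C ∖ V(H)) (D ∖ V(H))|`. [folklore] -/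
theorem card_kext (hlab : lab ∈ partitions n m k) (hH : H ∈ cdMatchings lab r) (hrk : r ≤ k) :
    (kext lab k H).card = (bipPM (restBlk lab H true) (restBlk lab H false)).card := by
  classical
  have hHpm : IsPMOn (verts H) H := isPMOn_verts hH
  obtain ⟨hHcd, hHcard, hHdisj⟩ := mem_cdMatchings_iff.1 hH
  have hdis := verts_disjoint_rest (lab := lab) (H := H)
  have hsplit := blkC_eq_verts_union_rest hH
  have hrest := biUnion_restBlk lab H
  -- forward: `F ∖ H ∈ bipPM`
  have hF : ∀ F ∈ kext lab k H, F \ H ∈ bipPM (restBlk lab H true) (restBlk lab H false) := by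
    intro F hFm
    obtain ⟨hFk, hHF⟩ := mem_filter.1 hFm
    have hFpm := isPMOn_of_mem_cdMatchings_k hlab hFk
    rw [hsplit] at hFpm
    have hG : IsPMOn ((univ : Finset Bool).biUnion (restBlk lab H)) (F \ H) := hFpm.sdiff hdis hHpm hHF
    rw [hrest] at hG
    refine mem_bipPM_iff.2 ⟨hG, fun e he => ?_⟩
    obtain ⟨heF, heH⟩ := mem_sdiff.1 he
    obtain ⟨c, d, rfl, hc, hd⟩ := (mem_cdMatchings_iff.1 hFk).1 e heF
    have hcv : c ∉ verts H := fun h => disjoint_left.1 hdis h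
      (by rw [hrest]; exact hG.mem_of_mem he (Sym2.mem_mk_left c d))
    have hdv : d ∉ verts H := fun h => disjoint_left.1 hdis h
      (by rw [hrest]; exact hG.mem_of_mem he (Sym2.mem_mk_right c d))
    exact ⟨c, mem_filter.2 ⟨mem_lblk.2 hc, hcv⟩, d, mem_filter.2 ⟨mem_lblk.2 hd, hdv⟩, rfl⟩
  -- backward: `G ∪ H ∈ kext`
  have hG : ∀ G ∈ bipPM (restBlk lab H true) (restBlk lab H false), G ∪ H ∈ kext lab k H ∧ Disjoint G H := by
    intro G hGm
    obtain ⟨hGpm, hGbip⟩ := mem_bipPM_iff.1 hGm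
    rw [← hrest] at hGpm
    have hGH : Disjoint G H := by
      rw [disjoint_left]
      intro e heG heH
      obtain ⟨a, ha, b, hb, rfl⟩ := hGbip e heG
      exact (mem_filter.1 ha).2 (mem_verts.2 ⟨_, heH, Sym2.mem_mk_left a b⟩)
    have hunion : IsPMOn (blkC lab Lbl.C) (G ∪ H) := by
      rw [hsplit, union_comm G H]
      exact hHpm.union hGpm hdis
    refine ⟨mem_filter.2 ⟨mem_cdMatchings_iff.2 ⟨fun e he => ?_, ?_, fun e he e' he' v hv hv' => ?_⟩,
      subset_union_right⟩, hGH⟩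
    · rcases mem_union.1 he with he | he
      · obtain ⟨a, ha, b, hb, rfl⟩ := hGbip e he
        exact ⟨a, b, rfl, mem_lblk.1 (mem_filter.1 ha).1, mem_lblk.1 (mem_filter.1 hb).1⟩
      · exact hHcd e he
    · -- `|G ∪ H| = (k - r) + r`
      have h2G := hGpm.two_mul_card
      rw [hrest, card_union_of_disjoint (restBlk_disjoint true false (by decide)),
        card_restBlk hlab hH, card_restBlk hlab hH] at h2G
      rw [card_union_of_disjoint hGH, hHcard]
      omega
    · exact hunion.unique he he' hv hv'
  refine card_nbij' (fun F => F \ H) (fun G => G ∪ H) (fun F hFm => ?_) (fun G hGm => ?_)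
    (fun F hFm => ?_) (fun G hGm => ?_)
  · exact mem_coe.2 (hF F (mem_coe.1 hFm))
  · exact mem_coe.2 (hG G (mem_coe.1 hGm)).1
  · exact sdiff_union_of_subset (mem_filter.1 (mem_coe.1 hFm)).2
  · exact union_sdiff_cancel_right (hG G (mem_coe.1 hGm)).2

/-- **The number `c₁` of `k`-matchings containing an `r`-matching `H` does not depend on
`(T, H)`.** [cite: Rothvoss2017, §3.4 (PDF p. 10)] -/
theorem card_kext_eq {lab' : Fin n → Lbl m} {H' : Finset (Sym2 (Fin n))}
    (hlab : lab ∈ partitions n m k) (hH : H ∈ cdMatchings lab r)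
    (hlab' : lab' ∈ partitions n m k) (hH' : H' ∈ cdMatchings lab' r) (hrk : r ≤ k) :
    (kext lab k H).card = (kext lab' k H').card := by
  rw [card_kext hlab hH hrk, card_kext hlab' hH' hrk]
  exact card_bipPM_eq_of_card_eq
    (by rw [card_restBlk hlab hH, card_restBlk hlab' hH'])
    (by rw [card_restBlk hlab hH, card_restBlk hlab' hH'])
    (restBlk_disjoint true false (by decide)) (restBlk_disjoint true false (by decide))

/-- The `3`-matchings inside a `k`-matching `F` are its `3`-subsets. [folklore] -/
theorem filter_cdMatchings_subset_eq_powersetCard {F : Finset (Sym2 (Fin n))} (hF : F ∈ cdMatchings lab k) (s : ℕ) :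
    ((cdMatchings lab s).filter fun H => H ⊆ F) = F.powersetCard s := by
  obtain ⟨hFcd, -, hFdisj⟩ := mem_cdMatchings_iff.1 hF
  ext H
  rw [mem_filter, mem_powersetCard, mem_cdMatchings_iff]
  constructor
  · rintro ⟨⟨-, hcard, -⟩, hsub⟩; exact ⟨hsub, hcard⟩
  · rintro ⟨hsub, hcard⟩
    exact ⟨⟨fun e he => hFcd e (hsub he), hcard, fun e he e' he' v hv hv' => hFdisj e (hsub he) e' (hsub he') v hv hv'⟩, hsub⟩

/-- **Double counting the pairs `H ⊆ F`**: `Σ_{H ∈ cdM_s} |kext H| = |cdM_k| · C(k, s)`.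
[cite: Rothvoss2017, §3.4 (PDF p. 10)] -/
theorem sum_card_kext (lab : Fin n → Lbl m) (k s : ℕ) :
    ∑ H ∈ cdMatchings lab s, (kext lab k H).card = (cdMatchings lab k).card * k.choose s := by
  classical
  have hpairs : ∑ H ∈ cdMatchings lab s, (kext lab k H).card =
      ∑ F ∈ cdMatchings lab k, ((cdMatchings lab s).filter fun H => H ⊆ F).card := by
    simp only [kext, card_filter]
    exact sum_comm
  rw [hpairs]
  have : ∀ F ∈ cdMatchings lab k, ((cdMatchings lab s).filter fun H => H ⊆ F).card = k.choose s := by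
    intro F hF
    rw [filter_cdMatchings_subset_eq_powersetCard hF, card_powersetCard, (mem_cdMatchings_iff.1 hF).2.1]
  rw [sum_congr rfl this, sum_const, smul_eq_mul]

end KExt

/-! ### `|U^ex(T, H)| = C(m, j)` -/

section UExt

variable {lab : Fin n → Lbl m} {r t : ℕ} {H : Finset (Sym2 (Fin n))}

/-- The cut with `A`-blocks `I`: `V(H) ∩ C` together with `⋃_{i ∈ I} A_i`. [folklore] -/
def mkU (lab : Fin n → Lbl m) (H : Finset (Sym2 (Fin n))) (I : Finset (Fin m)) : Finset (Fin n) :=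
  cov lab H ∪ univ.filter fun v => ∃ i ∈ I, lab v = Lbl.A i

/-- The `A`-blocks meeting a cut. [folklore] -/
def idxU (lab : Fin n → Lbl m) (U : Finset (Fin n)) : Finset (Fin m) :=
  univ.filter fun i => ∃ v ∈ U, lab v = Lbl.A i

/-- The `A`-part of `mkU` has `|I| · (k-3)` elements. [folklore] -/
theorem card_filter_Apart (hlab : lab ∈ partitions n m k) (I : Finset (Fin m)) :
    (univ.filter fun v => ∃ i ∈ I, lab v = Lbl.A i).card = I.card * (k - 3) := by
  have hbi : (univ.filter fun v => ∃ i ∈ I, lab v = Lbl.A i) = I.biUnion fun i => lblk lab (Lbl.A i) := by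
    ext v
    simp only [mem_filter, mem_univ, true_and, mem_biUnion, mem_lblk]
  rw [hbi, card_biUnion]
  · rw [sum_congr rfl fun i _ => (mem_partitions_iff.1 hlab) (Lbl.A i)]
    simp only [Lbl.size, sum_const, smul_eq_mul]
  · intro i _ i' _ hne
    rw [Function.onFun, disjoint_left]
    intro v hv hv'
    rw [mem_lblk] at hv hv'
    have := hv.symm.trans hv'
    simp only [Lbl.A.injEq] at this
    exact hne this

/-- **`mkU I ∈ U^ex(T, H)`** when `|I| (k-3) + r = t`. [cite: Rothvoss2017, §3.1 (PDF p. 8)] -/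
theorem mkU_mem_Uext (hlab : lab ∈ partitions n m k) (hH : H ∈ cdMatchings lab r) (I : Finset (Fin m))
    (ht : r + I.card * (k - 3) = t) : mkU lab H I ∈ Uext lab t H := by
  classical
  have hAlab : ∀ v ∈ (univ.filter fun v => ∃ i ∈ I, lab v = Lbl.A i), ∃ i ∈ I, lab v = Lbl.A i :=
    fun v hv => (mem_filter.1 hv).2
  have hcovlab : ∀ v ∈ cov lab H, lab v = Lbl.C := fun v hv => (mem_cov_iff.1 hv).1
  have hdisj : Disjoint (cov lab H) (univ.filter fun v => ∃ i ∈ I, lab v = Lbl.A i) := by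
    rw [disjoint_left]
    intro v hv hv'
    obtain ⟨i, -, hi⟩ := hAlab v hv'
    have := (hcovlab v hv).symm.trans hi
    cases this
  refine mem_Uext_iff.2 ⟨mem_Uall_iff.2 ⟨?_, ?_, ?_⟩, ?_⟩
  · rw [mkU, card_union_of_disjoint hdisj, card_cov hH, card_filter_Apart hlab I, ht]
  · intro v hv
    rcases mem_union.1 hv with hv | hv
    · rw [hcovlab v hv]; rfl
    · obtain ⟨i, -, hi⟩ := hAlab v hv
      rw [hi]; rfl
  · intro u hu v hvu hA
    rcases mem_union.1 hu with hu | hu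
    · rw [hcovlab u hu] at hA
      exact absurd hA (by simp [Lbl.isA])
    · obtain ⟨i, hiI, hi⟩ := hAlab u hu
      exact mem_union_right _ (mem_filter.2 ⟨mem_univ _, i, hiI, by rw [hvu, hi]⟩)
  · ext v
    simp only [mkU, mem_inter, mem_union, mem_lblk]
    constructor
    · rintro ⟨hv | hv, hC⟩
      · exact hv
      · obtain ⟨i, -, hi⟩ := hAlab v hv
        rw [hi] at hC; cases hC
    · intro hv
      exact ⟨Or.inl hv, hcovlab v hv⟩

/-- A member of `U^ex(T, H)` is `mkU` of its `A`-blocks. [folklore] -/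
theorem mkU_idxU {U : Finset (Fin n)} (hU : U ∈ Uext lab t H) :
    mkU lab H (idxU lab U) = U := by
  obtain ⟨hUall, hUC⟩ := mem_Uext_iff.1 hU
  obtain ⟨-, hAC, hwhole⟩ := mem_Uall_iff.1 hUall
  ext v
  simp only [mkU, idxU, mem_union, mem_filter, mem_univ, true_and]
  constructor
  · rintro (hv | ⟨i, ⟨u, hu, hui⟩, hvi⟩)
    · rw [← hUC] at hv; exact (mem_inter.1 hv).1
    · exact hwhole u hu v (by rw [hvi, hui]) (by rw [hui]; rfl)
  · intro hv
    have hvAC := hAC v hv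
    cases hlv : lab v with
    | A i => exact Or.inr ⟨i, ⟨v, hv, hlv⟩, rfl⟩
    | C => left; rw [← hUC]; exact mem_inter.2 ⟨hv, mem_lblk.2 hlv⟩
    | D => rw [hlv] at hvAC; exact absurd hvAC (by simp [Lbl.isAC])
    | B i => rw [hlv] at hvAC; exact absurd hvAC (by simp [Lbl.isAC])

/-- The `A`-blocks of `mkU I` are `I` (blocks are nonempty as `k > 3`). [folklore] -/
theorem idxU_mkU (hlab : lab ∈ partitions n m k) (hk : 3 < k) (I : Finset (Fin m)) :
    idxU lab (mkU lab H I) = I := by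
  ext i
  simp only [idxU, mkU, mem_filter, mem_univ, true_and, mem_union]
  constructor
  · rintro ⟨v, hv | ⟨j, hj, hvj⟩, hvi⟩
    · have := (mem_cov_iff.1 hv).1; rw [hvi] at this; cases this
    · rw [hvi] at hvj; simp only [Lbl.A.injEq] at hvj; rw [hvj]; exact hj
  · intro hi
    -- the block `A i` is nonempty
    have hcard : (lblk lab (Lbl.A i)).card = k - 3 := (mem_partitions_iff.1 hlab) (Lbl.A i)
    obtain ⟨v, hv⟩ : (lblk lab (Lbl.A i)).Nonempty := by
      rw [← card_pos, hcard]; omega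
    rw [mem_lblk] at hv
    exact ⟨v, Or.inr ⟨i, hi, hv⟩, hv⟩

/-- The number of `A`-blocks of a member of `U^ex(T,H)` is `j` when `t = r + j(k-3)`, `k > 3`.
[folklore] -/
theorem card_idxU (hlab : lab ∈ partitions n m k) (hH : H ∈ cdMatchings lab r) (hk : 3 < k)
    {j : ℕ} (ht : r + j * (k - 3) = t) {U : Finset (Fin n)} (hU : U ∈ Uext lab t H) :
    (idxU lab U).card = j := by
  classical
  have hU' := mkU_idxU hU
  have hcard : U.card = t := (mem_Uall_iff.1 (mem_Uext_iff.1 hU).1).1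
  have hdisj : Disjoint (cov lab H) (univ.filter fun v => ∃ i ∈ idxU lab U, lab v = Lbl.A i) := by
    rw [disjoint_left]
    intro v hv hv'
    obtain ⟨i, -, hi⟩ := (mem_filter.1 hv').2
    have := ((mem_cov_iff.1 hv).1).symm.trans hi
    cases this
  have h1 : (mkU lab H (idxU lab U)).card = r + (idxU lab U).card * (k - 3) := by
    rw [mkU, card_union_of_disjoint hdisj, card_cov hH, card_filter_Apart hlab]
  rw [hU', hcard, ← ht] at h1
  have h2 : (idxU lab U).card * (k - 3) = j * (k - 3) := by omega
  exact Nat.eq_of_mul_eq_mul_right (by omega) h2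

/-- **`|U^ex(T, H)| = C(m, j)`** for `t = r + j(k-3)` (`k > 3`): the members of `U^ex(T,H)`
correspond to the `j`-sets of `A`-blocks. [cite: Rothvoss2017, §3.1 (PDF p. 8)] -/
theorem card_Uext (hlab : lab ∈ partitions n m k) (hH : H ∈ cdMatchings lab r) (hk : 3 < k) {j : ℕ}
    (ht : r + j * (k - 3) = t) : (Uext lab t H).card = m.choose j := by
  classical
  rw [show m.choose j = ((univ : Finset (Fin m)).powersetCard j).card by
    rw [card_powersetCard, card_fin]]
  refine card_nbij' (fun U => idxU lab U) (fun I => mkU lab H I) (fun U hU => ?_) (fun I hI => ?_)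
    (fun U hU => ?_) (fun I hI => ?_)
  · rw [mem_coe] at hU
    rw [mem_coe, mem_powersetCard]
    exact ⟨subset_univ _, card_idxU hlab hH hk ht hU⟩
  · rw [mem_coe, mem_powersetCard] at hI
    rw [mem_coe]
    exact mkU_mem_Uext hlab hH I (by rw [hI.2]; exact ht)
  · exact mkU_idxU (mem_coe.1 hU)
  · exact idxU_mkU hlab hk I

end UExt

end Literature.Barriers.PneNP
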